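import Summits.AtomisticToContinuum.FouriersLaw.Theorems.EmbeddedDrudeMourreDrudeDissolutionStubPencilDerivationAlgebra
import Summits.AtomisticToContinuum.FouriersLaw.Theorems.EmbeddedDrudeMourreDrudeDissolutionStubPencilDerivationCore
import Summits.AtomisticToContinuum.FouriersLaw.Theorems.EmbeddedDrudeMourreDrudeDissolutionStubPencilDerivationDomain
import HarnessLib

/-!
# Stub C `stub_pencilDerivation` of line `gram-pencil-harmonic-chaos`
(crux `EmbeddedDrudeMourre.DrudeDissolution`, item stmt-AtomisticToContinuum-12593; `--supports` file
proving the registered stub C verbatim, closes nothing)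

WHAT. (i) The Liouville operator `liouvilleZ (pinnedChain ω₂ lam β γ)` maps the algebra `𝒫` of local
polynomials into itself; (ii) for every zero-wavenumber datum `Z` of `pinnedChain ω₂ lam β 1` as delivered
by stub F (DLR state at `T = 1`, dynamics the identity off `bmGood = D.carrier`, strongly continuous Koopman
group, observables = flow-orbit of `𝒫`): (ii-a) `t ↦ U_t [u]` has derivative `[liouvilleZ P u]` at `0` in
`ℋ₀(Z.μ)` for every `u ∈ 𝒫` — Doyon's generator is the class map of `liouvilleZ` on polynomial classes —
and (ii-b) the span of the local classes `[w]`, `w ∈ Z.localObs`, is a core of the generator.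

HOW. Assembly of the landed sub-goals: `stub_pencilDerivation_algebra` (i; `MvPolynomial` calculus),
`stub_pencilDerivation_domain` ((ii-a), unconditionally: Følner representation of the `ℋ₀` norm +
finite-volume time averages + stationarity + dominated convergence — no uniform-in-time clustering is
needed) and `stub_pencilDerivation_core` ((ii-a) ⇒ (ii-b), Engel–Nagel's core lemma for the Stone
generator). The hypotheses `0 < ω₂`, `0 ≤ lam`, `0 ≤ β` and the Gibbs property of `Z.μ` are not used.
-/

noncomputable section

open MeasureTheory Filter Set Function Topology
open scoped InnerProductSpace ENNReal
open Literature.MathematicalPhysics.KineticTheory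
open Literature.MathematicalPhysics.KineticTheory.HeatConduction
open Literature.MathematicalPhysics.KineticTheory.PhononBoltzmann

namespace Summit.AtomisticToContinuum.FouriersLaw.Theorems.DrudeDissolution.GramPencilHarmonicChaos

/-- **STUB C** (`stub_pencilDerivation`): `liouvilleZ` maps local polynomials to local polynomials, is
the Koopman generator on their classes, and the local classes form a core.
[cite: Doyon2022, §4.2 eqs. (4.9)–(4.10), Thm 4.11] [cite: EngelNagel2000, Ch. II Prop. 1.7] -/
theorem stub_pencilDerivation : (∀ ω₂ lam β γ : ℝ, ∀ u ∈ Algebra.adjoin ℝ (Set.range fun xc : ℤ × Bool => fun σ : ChainConfig => if xc.2 then (σ xc.1).2 else (σ xc.1).1), liouvilleZ (pinnedChain ω₂ lam β γ) u ∈ Algebra.adjoin ℝ (Set.range fun xc : ℤ × Bool => fun σ : ChainConfig => if xc.2 then (σ xc.1).2 else (σ xc.1).1)) ∧ ∀ ω₂ lam β : ℝ, 0 < ω₂ → 0 ≤ lam → 0 ≤ β → ∀ (D : InfiniteChainDynamics (pinnedChain ω₂ lam β 1)) (Z : ZeroWavenumberData (pinnedChain ω₂ lam β 1) D), (pinnedChain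 ω₂ lam β 1).IsChainGibbsMeasure 1 Z.μ → D.carrier = (pinnedChain ω₂ lam β 1).bmGood → (∀ (t : ℝ) (σ : ChainConfig), σ ∉ (pinnedChain ω₂ lam β 1).bmGood → D.flow t σ = σ) → Z.toFluctuationDynamics.IsStronglyContinuous → Z.localObs = Submodule.span ℝ {w : ChainConfig → ℝ | ∃ u ∈ Algebra.adjoin ℝ (Set.range fun xc : ℤ × Bool => fun σ : ChainConfig => if xc.2 then (σ xc.1).2 else (σ xc.1).1), ∃ s : ℝ, w = u ∘ D.flow s} → (∀ u ∈ Algebra.adjoin ℝ (Set.range fun xc : ℤ × Bool => fun σ : ChainConfig => if xc.2 then (σ xc.1).2 else (σ xc.1).1), HasDerivAt (fun t : ℝ => (Z.koopman t (Z.fluct u) : ZeroWavenumberSpace Z)) (Z.fluct (liouvilleZ (pinnedChain ω₂ lam β 1) u)) 0) ∧ Z.generator.HasCore (Submodule.span ℝ {ψ : ZeroWavenumberSpace Z | ∃ w ∈ Z.localObs, ψ = Z.fluct w}) := by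
  refine ⟨stub_pencilDerivation_algebra, ?_⟩
  intro ω₂ lam β _ _ _ D Z _ hcar hoff hU hloc
  have hgen := stub_pencilDerivation_domain ω₂ lam β 1 D Z hcar hoff hU hloc
  exact ⟨hgen, stub_pencilDerivation_core ω₂ lam β D Z hcar hoff hU hloc hgen⟩

end Summit.AtomisticToContinuum.FouriersLaw.Theorems.DrudeDissolution.GramPencilHarmonicChaos

end
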